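import Mathlib
import Literature.NumberTheory.UniformDistribution.Invariances

/-!
# Fourier-side helpers for the slackness transfer of route `BraggSlacknessRigidity`
# (item `stmt-AtomisticToContinuum-13170`, `SlacknessTransfer`)

Analysis lemmas used by `BraggSlacknessRigiditySlacknessTransfer.lean` (the proof of
`BraggSlacknessRigidity.SlacknessTransfer`), kept potential-free:

* `exists_pos_forall_le_of_isCompact`, `tendsto_zero_of_abs_eventually_le` — generic helpers;
* the structure factor `|S_N(ξ)|² = |∑ⱼ e^{2πi⟨ξ,yⱼ⟩}|²` of a finite configuration in `ℝ³`:
  continuity, the bound `≤ N²`, and the phase identity `∑ᵢ∑ⱼ e^{2πi⟨ξ,yᵢ-yⱼ⟩} = |S_N(ξ)|²`;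
* **the quadratic-form identity** `∑ᵢ∑ⱼ F(yᵢ - yⱼ) = ∫ 𝓕F(ξ) |S_N(ξ)|² dξ` for `F` continuous and
  integrable with integrable Fourier transform (Mathlib's Fourier inversion
  `Continuous.fourierInv_fourier_eq` and `Real.fourierInv_eq'`, finite sums through the
  integral), its real radial form, and the comparison
  `|∫ h |S_N|²| ≤ (M/m) ∫ Re 𝓕F |S_N|²` when `|h| ≤ M`, `Re 𝓕F ≥ 0`, and `Re 𝓕F ≥ m > 0` on
  `tsupport h`.

All `[folklore]`.
-/

noncomputable section

namespace Summit.AtomisticToContinuum.Crystallization.Theorems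

open MeasureTheory Filter
open scoped BigOperators Topology FourierTransform RealInnerProductSpace ComplexConjugate

namespace BraggSlacknessTransfer

/-! ## Generic helpers -/

/-- A function continuous and positive on a compact set has a positive uniform lower bound there
(also when the set is empty). [folklore] -/
theorem exists_pos_forall_le_of_isCompact {α : Type*} [TopologicalSpace α] {K : Set α}
    (hK : IsCompact K) {u : α → ℝ} (hu : ContinuousOn u K) (hpos : ∀ z ∈ K, 0 < u z) :
    ∃ m : ℝ, 0 < m ∧ ∀ z ∈ K, m ≤ u z := by
  rcases K.eq_empty_or_nonempty with h | h
  · exact ⟨1, one_pos, fun z hz => by simp [h] at hz⟩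
  · obtain ⟨z₀, hz₀, hmin⟩ := hK.exists_isMinOn h hu
    exact ⟨u z₀, hpos z₀ hz₀, fun z hz => hmin hz⟩

/-- A real sequence whose absolute value is eventually below every `ε > 0` tends to `0`.
[folklore] -/
theorem tendsto_zero_of_abs_eventually_le {u : ℕ → ℝ}
    (h : ∀ ε : ℝ, 0 < ε → ∀ᶠ N in atTop, |u N| ≤ ε) : Tendsto u atTop (𝓝 0) := by
  rw [Metric.tendsto_nhds]
  intro ε hε
  filter_upwards [h (ε / 2) (half_pos hε)] with N hN
  rw [Real.dist_0_eq_abs]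
  linarith

/-! ## The structure factor and the quadratic-form identity -/

/-- `e^{2πi⟨ξ,u-v⟩} = e^{2πi⟨ξ,u⟩} · conj e^{2πi⟨ξ,v⟩}`. [folklore] -/
theorem phase_sub (ξ u v : EuclideanSpace ℝ (Fin 3)) :
    Complex.exp (↑(2 * Real.pi * ⟪ξ, u - v⟫) * Complex.I) =
      Complex.exp (2 * Real.pi * Complex.I * (⟪ξ, u⟫ : ℂ)) *
        conj (Complex.exp (2 * Real.pi * Complex.I * (⟪ξ, v⟫ : ℂ))) := by
  rw [← Complex.exp_conj, ← Complex.exp_add, inner_sub_right]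
  congr 1
  simp only [map_mul, map_ofNat, Complex.conj_ofReal, Complex.conj_I]
  push_cast
  ring

/-- The double phase sum is the squared modulus of the structure factor:
`∑ᵢ∑ⱼ e^{2πi⟨ξ,yᵢ-yⱼ⟩} = |∑ⱼ e^{2πi⟨ξ,yⱼ⟩}|²`. [folklore] -/
theorem sum_sum_phase_sub {N : ℕ} (y : Fin N → EuclideanSpace ℝ (Fin 3))
    (ξ : EuclideanSpace ℝ (Fin 3)) :
    ∑ i, ∑ j, Complex.exp (↑(2 * Real.pi * ⟪ξ, y i - y j⟫) * Complex.I) =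
      ((‖∑ j, Complex.exp (2 * Real.pi * Complex.I * (⟪ξ, y j⟫ : ℂ))‖ ^ 2 : ℝ) : ℂ) := by
  rw [← Complex.normSq_eq_norm_sq, ← Complex.mul_conj, map_sum, Finset.sum_mul_sum]
  exact Finset.sum_congr rfl fun i _ => Finset.sum_congr rfl fun j _ => phase_sub ξ (y i) (y j)

/-- The structure factor `|∑ⱼ e^{2πi⟨ξ,yⱼ⟩}|²` is continuous in `ξ`. [folklore] -/
theorem continuous_sf {N : ℕ} (y : Fin N → EuclideanSpace ℝ (Fin 3)) :
    Continuous fun ξ : EuclideanSpace ℝ (Fin 3) =>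
      ‖∑ j, Complex.exp (2 * Real.pi * Complex.I * (⟪ξ, y j⟫ : ℂ))‖ ^ 2 := by
  fun_prop

/-- The structure factor is bounded by `N²`. [folklore] -/
theorem sf_le {N : ℕ} (y : Fin N → EuclideanSpace ℝ (Fin 3)) (ξ : EuclideanSpace ℝ (Fin 3)) :
    ‖∑ j, Complex.exp (2 * Real.pi * Complex.I * (⟪ξ, y j⟫ : ℂ))‖ ^ 2 ≤ (N : ℝ) ^ 2 := by
  have h : ‖∑ j, Complex.exp (2 * Real.pi * Complex.I * (⟪ξ, y j⟫ : ℂ))‖ ≤ N := by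
    refine (norm_sum_le _ _).trans ?_
    simp [Literature.NumberTheory.UniformDistribution.norm_cexp_two_pi_mul_ofReal]
  exact pow_le_pow_left₀ (norm_nonneg _) h 2

/-- The Fourier transform of an integrable function on `ℝ³` is continuous. [folklore] -/
theorem continuous_fourier' {F : EuclideanSpace ℝ (Fin 3) → ℂ} (hF : Integrable F) :
    Continuous (𝓕 F) :=
  VectorFourier.fourierIntegral_continuous Real.continuous_fourierChar
    (by exact continuous_inner) hF

/-- `𝓕F · |S_N|²` is integrable when `𝓕F` is. [folklore] -/
theorem integrable_fourier_mul_sf {F : EuclideanSpace ℝ (Fin 3) → ℂ} (hFF : Integrable (𝓕 F))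
    {N : ℕ} (y : Fin N → EuclideanSpace ℝ (Fin 3)) :
    Integrable fun ξ : EuclideanSpace ℝ (Fin 3) => 𝓕 F ξ *
      ((‖∑ j, Complex.exp (2 * Real.pi * Complex.I * (⟪ξ, y j⟫ : ℂ))‖ ^ 2 : ℝ) : ℂ) := by
  refine hFF.mul_bdd (c := (N : ℝ) ^ 2) ?_ (ae_of_all _ fun ξ => ?_)
  · exact (Complex.continuous_ofReal.comp (continuous_sf y)).aestronglyMeasurable
  · rw [Complex.norm_real, Real.norm_eq_abs, abs_of_nonneg (by positivity)]
    exact sf_le y ξ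

/-- `Re 𝓕F · |S_N|²` is integrable when `𝓕F` is. [folklore] -/
theorem integrable_fourier_re_mul_sf {F : EuclideanSpace ℝ (Fin 3) → ℂ}
    (hFF : Integrable (𝓕 F)) {N : ℕ} (y : Fin N → EuclideanSpace ℝ (Fin 3)) :
    Integrable fun ξ : EuclideanSpace ℝ (Fin 3) => (𝓕 F ξ).re *
      ‖∑ j, Complex.exp (2 * Real.pi * Complex.I * (⟪ξ, y j⟫ : ℂ))‖ ^ 2 := by
  have hre : Integrable fun ξ : EuclideanSpace ℝ (Fin 3) => (𝓕 F ξ).re := by simpa using hFF.re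
  refine hre.mul_bdd (c := (N : ℝ) ^ 2) (continuous_sf y).aestronglyMeasurable
    (ae_of_all _ fun ξ => ?_)
  rw [Real.norm_eq_abs, abs_of_nonneg (by positivity)]
  exact sf_le y ξ

/-- **The quadratic-form identity (Fourier inversion).** For `F` continuous and integrable on
`ℝ³` with integrable Fourier transform,
`∑ᵢ∑ⱼ F(yᵢ - yⱼ) = ∫ 𝓕F(ξ) |∑ⱼ e^{2πi⟨ξ,yⱼ⟩}|² dξ`. [folklore] -/
theorem sum_sum_eq_integral_fourier {F : EuclideanSpace ℝ (Fin 3) → ℂ} (hFc : Continuous F)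
    (hFi : Integrable F) (hFF : Integrable (𝓕 F)) {N : ℕ} (y : Fin N → EuclideanSpace ℝ (Fin 3)) :
    ∑ i, ∑ j, F (y i - y j) =
      ∫ ξ : EuclideanSpace ℝ (Fin 3), 𝓕 F ξ *
        ((‖∑ j, Complex.exp (2 * Real.pi * Complex.I * (⟪ξ, y j⟫ : ℂ))‖ ^ 2 : ℝ) : ℂ) := by
  have hinv : 𝓕⁻ (𝓕 F) = F := hFc.fourierInv_fourier_eq hFi hFF
  have hterm : ∀ w : EuclideanSpace ℝ (Fin 3),
      F w = ∫ ξ : EuclideanSpace ℝ (Fin 3),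
        Complex.exp (↑(2 * Real.pi * ⟪ξ, w⟫) * Complex.I) * 𝓕 F ξ := by
    intro w
    have h1 : F w = 𝓕⁻ (𝓕 F) w := by rw [hinv]
    rw [h1, Real.fourierInv_eq']
    simp only [smul_eq_mul]
  have hint : ∀ w : EuclideanSpace ℝ (Fin 3),
      Integrable fun ξ : EuclideanSpace ℝ (Fin 3) =>
        Complex.exp (↑(2 * Real.pi * ⟪ξ, w⟫) * Complex.I) * 𝓕 F ξ := by
    intro w
    refine hFF.bdd_mul (c := 1) ?_ (ae_of_all _ fun ξ => ?_)
    · exact Continuous.aestronglyMeasurable (by fun_prop)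
    · exact (Complex.norm_exp_ofReal_mul_I _).le
  symm
  calc ∫ ξ : EuclideanSpace ℝ (Fin 3), 𝓕 F ξ *
        ((‖∑ j, Complex.exp (2 * Real.pi * Complex.I * (⟪ξ, y j⟫ : ℂ))‖ ^ 2 : ℝ) : ℂ)
      = ∫ ξ : EuclideanSpace ℝ (Fin 3), ∑ i, ∑ j,
          Complex.exp (↑(2 * Real.pi * ⟪ξ, y i - y j⟫) * Complex.I) * 𝓕 F ξ := by
        refine integral_congr_ae (ae_of_all _ fun ξ => ?_)
        simp only
        rw [mul_comm, ← sum_sum_phase_sub y ξ, Finset.sum_mul]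
        exact Finset.sum_congr rfl fun i _ => Finset.sum_mul _ _ _
    _ = ∑ i, ∫ ξ : EuclideanSpace ℝ (Fin 3), ∑ j,
          Complex.exp (↑(2 * Real.pi * ⟪ξ, y i - y j⟫) * Complex.I) * 𝓕 F ξ :=
        integral_finsetSum _ fun i _ => integrable_finsetSum _ fun j _ => hint _
    _ = ∑ i, ∑ j, ∫ ξ : EuclideanSpace ℝ (Fin 3),
          Complex.exp (↑(2 * Real.pi * ⟪ξ, y i - y j⟫) * Complex.I) * 𝓕 F ξ :=
        Finset.sum_congr rfl fun i _ => integral_finsetSum _ fun j _ => hint _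
    _ = ∑ i, ∑ j, F (y i - y j) :=
        Finset.sum_congr rfl fun i _ => Finset.sum_congr rfl fun j _ => (hterm _).symm

/-- Real, radial form of the identity: for `F(v) = f(‖v‖)`,
`∑ᵢ∑ⱼ f(|yᵢ - yⱼ|) = ∫ Re 𝓕F(ξ) · |∑ⱼ e^{2πi⟨ξ,yⱼ⟩}|² dξ`. [folklore] -/
theorem sum_sum_radial_eq_integral {f : ℝ → ℝ}
    (hFc : Continuous fun v : EuclideanSpace ℝ (Fin 3) => (f ‖v‖ : ℂ))
    (hFi : Integrable fun v : EuclideanSpace ℝ (Fin 3) => (f ‖v‖ : ℂ))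
    (hFF : Integrable (𝓕 fun v : EuclideanSpace ℝ (Fin 3) => (f ‖v‖ : ℂ))) {N : ℕ}
    (y : Fin N → EuclideanSpace ℝ (Fin 3)) :
    ∑ i, ∑ j, f (dist (y i) (y j)) =
      ∫ ξ : EuclideanSpace ℝ (Fin 3),
        (𝓕 (fun v : EuclideanSpace ℝ (Fin 3) => (f ‖v‖ : ℂ)) ξ).re *
        ‖∑ j, Complex.exp (2 * Real.pi * Complex.I * (⟪ξ, y j⟫ : ℂ))‖ ^ 2 := by
  set F : EuclideanSpace ℝ (Fin 3) → ℂ := fun v => (f ‖v‖ : ℂ) with hFdef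
  have h := sum_sum_eq_integral_fourier hFc hFi hFF y
  have hint := integrable_fourier_mul_sf hFF y
  have h2 : (∫ ξ : EuclideanSpace ℝ (Fin 3), 𝓕 F ξ *
      ((‖∑ j, Complex.exp (2 * Real.pi * Complex.I * (⟪ξ, y j⟫ : ℂ))‖ ^ 2 : ℝ) : ℂ)).re =
      ∫ ξ : EuclideanSpace ℝ (Fin 3), (𝓕 F ξ).re *
        ‖∑ j, Complex.exp (2 * Real.pi * Complex.I * (⟪ξ, y j⟫ : ℂ))‖ ^ 2 := by
    rw [← RCLike.re_to_complex, ← integral_re hint]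
    refine integral_congr_ae (ae_of_all _ fun ξ => ?_)
    simp only [RCLike.re_to_complex, Complex.mul_re, Complex.ofReal_re, Complex.ofReal_im,
      mul_zero, sub_zero]
  have h3 := congrArg Complex.re h
  rw [h2] at h3
  rw [← h3, Complex.re_sum]
  refine Finset.sum_congr rfl fun i _ => ?_
  rw [Complex.re_sum]
  refine Finset.sum_congr rfl fun j _ => ?_
  simp [hFdef, dist_eq_norm]

/-- **Pointwise-to-integral comparison.** If `|h| ≤ M`, `Re 𝓕F ≥ 0` everywhere and
`Re 𝓕F ≥ m > 0` on `tsupport h`, then `|∫ h |S_N|²| ≤ (M/m) ∫ Re 𝓕F |S_N|²`. [folklore] -/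
theorem abs_integral_sf_le {F : EuclideanSpace ℝ (Fin 3) → ℂ} (hFF : Integrable (𝓕 F))
    (hFre : ∀ ξ : EuclideanSpace ℝ (Fin 3), 0 ≤ (𝓕 F ξ).re) {h : EuclideanSpace ℝ (Fin 3) → ℝ}
    {M m : ℝ} (hM : ∀ ξ, ‖h ξ‖ ≤ M) (hm : 0 < m) (hmin : ∀ ξ ∈ tsupport h, m ≤ (𝓕 F ξ).re)
    {N : ℕ} (y : Fin N → EuclideanSpace ℝ (Fin 3)) :
    |∫ ξ : EuclideanSpace ℝ (Fin 3),
        h ξ * ‖∑ j, Complex.exp (2 * Real.pi * Complex.I * (⟪ξ, y j⟫ : ℂ))‖ ^ 2| ≤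
      M / m * ∫ ξ : EuclideanSpace ℝ (Fin 3), (𝓕 F ξ).re *
        ‖∑ j, Complex.exp (2 * Real.pi * Complex.I * (⟪ξ, y j⟫ : ℂ))‖ ^ 2 := by
  have hM0 : 0 ≤ M := (norm_nonneg _).trans (hM 0)
  have hMm : 0 ≤ M / m := div_nonneg hM0 hm.le
  have hpt : ∀ ξ : EuclideanSpace ℝ (Fin 3),
      |h ξ * ‖∑ j, Complex.exp (2 * Real.pi * Complex.I * (⟪ξ, y j⟫ : ℂ))‖ ^ 2| ≤
        M / m * ((𝓕 F ξ).re *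
          ‖∑ j, Complex.exp (2 * Real.pi * Complex.I * (⟪ξ, y j⟫ : ℂ))‖ ^ 2) := by
    intro ξ
    have hA0 : 0 ≤ ‖∑ j, Complex.exp (2 * Real.pi * Complex.I * (⟪ξ, y j⟫ : ℂ))‖ ^ 2 := by
      positivity
    rw [abs_mul, abs_of_nonneg hA0]
    by_cases hξ : ξ ∈ tsupport h
    · have h1 : |h ξ| ≤ M / m * (𝓕 F ξ).re := by
        calc |h ξ| ≤ M := by simpa [Real.norm_eq_abs] using hM ξ
          _ = M / m * m := by field_simp
          _ ≤ M / m * (𝓕 F ξ).re := mul_le_mul_of_nonneg_left (hmin ξ hξ) hMm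
      calc |h ξ| * ‖∑ j, Complex.exp (2 * Real.pi * Complex.I * (⟪ξ, y j⟫ : ℂ))‖ ^ 2
          ≤ (M / m * (𝓕 F ξ).re) *
              ‖∑ j, Complex.exp (2 * Real.pi * Complex.I * (⟪ξ, y j⟫ : ℂ))‖ ^ 2 :=
            mul_le_mul_of_nonneg_right h1 hA0
        _ = _ := by ring
    · rw [image_eq_zero_of_notMem_tsupport hξ, abs_zero, zero_mul]
      exact mul_nonneg hMm (mul_nonneg (hFre ξ) hA0)
  have hint := integrable_fourier_re_mul_sf hFF y
  calc |∫ ξ : EuclideanSpace ℝ (Fin 3),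
          h ξ * ‖∑ j, Complex.exp (2 * Real.pi * Complex.I * (⟪ξ, y j⟫ : ℂ))‖ ^ 2|
      ≤ ∫ ξ : EuclideanSpace ℝ (Fin 3),
          |h ξ * ‖∑ j, Complex.exp (2 * Real.pi * Complex.I * (⟪ξ, y j⟫ : ℂ))‖ ^ 2| :=
        abs_integral_le_integral_abs
    _ ≤ ∫ ξ : EuclideanSpace ℝ (Fin 3), M / m * ((𝓕 F ξ).re *
          ‖∑ j, Complex.exp (2 * Real.pi * Complex.I * (⟪ξ, y j⟫ : ℂ))‖ ^ 2) :=
        integral_mono_of_nonneg (ae_of_all _ fun ξ => abs_nonneg _) (hint.const_mul _)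
          (ae_of_all _ hpt)
    _ = M / m * ∫ ξ : EuclideanSpace ℝ (Fin 3), (𝓕 F ξ).re *
          ‖∑ j, Complex.exp (2 * Real.pi * Complex.I * (⟪ξ, y j⟫ : ℂ))‖ ^ 2 :=
        integral_const_mul _ _

end BraggSlacknessTransfer

end Summit.AtomisticToContinuum.Crystallization.Theorems

end
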